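import Summits.Parity.BatemanHorn.Theorems.SoloInformedDirichletHyperbola

/-!
# SoloInformedHarmonicDecayConvolution — log-power decay of summatory functions is stable under Dirichlet convolution

Solo unit `solo-Parity-informed` (ideation tier, informed mode), session 17; `PLAN.md` §25.3 (α1), CLAIMS C83.

Say an arithmetic function `f` has *log-power decay* if for every `B` there is `C` with
`|∑_{n ≤ N} f(n)| ≤ C/(1 + log N)^B` (`N ≥ 1`), and is *log-power bounded* if
`∑_{n ≤ N} |f(n)| ≤ K (1 + log N)^κ` for some `K, κ`.  We prove:

* `logPowDecay_mul` — if `f, g` have log-power decay and are log-power bounded then `f*g` has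
  log-power decay (Dirichlet hyperbola identity at `Y = ⌊√T⌋`);
* `logPowDecay_mul_of_summable` — if `f` has log-power decay and `∑ |g(n)| n^δ < ∞` for some
  `δ > 0` then `f*g` has log-power decay.

Applied (in `SoloInformedSystemMoebiusDecay`) to `f(n) = μ(n)ρ_G(n)/n`, these propagate the decay
`∑_{n ≤ N} μ(n)ρ_g(n)/n = O((log N)^{-B})` from single irreducible polynomials (the sharp-cutoff
prime ideal theorem input, `Literature.NumberTheory.LFunctions.abs_sum_moebius_rootCount_div_le_log_pow`)
to the root-count function of an arbitrary Bateman–Horn system.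
-/

namespace Summit.Parity.BatemanHorn.Theorems

open Finset Real ArithmeticFunction
open Literature.Barriers.Parity (Icc_one_eq_Ioc_zero)

/-! ### Decay of convolutions -/

/-- **Log-power decay is stable under convolution of log-power bounded functions.** -/
theorem logPowDecay_mul {f g : ArithmeticFunction ℝ}
    (hf : ∀ B : ℕ, ∃ C : ℝ, ∀ N : ℕ, 1 ≤ N → |∑ n ∈ Icc 1 N, f n| ≤ C / (1 + Real.log N) ^ B)
    (hg : ∀ B : ℕ, ∃ C : ℝ, ∀ N : ℕ, 1 ≤ N → |∑ n ∈ Icc 1 N, g n| ≤ C / (1 + Real.log N) ^ B)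
    (hf' : ∃ (K : ℝ) (κ : ℕ), ∀ N : ℕ, 1 ≤ N → ∑ n ∈ Icc 1 N, |f n| ≤ K * (1 + Real.log N) ^ κ)
    (hg' : ∃ (K : ℝ) (κ : ℕ), ∀ N : ℕ, 1 ≤ N → ∑ n ∈ Icc 1 N, |g n| ≤ K * (1 + Real.log N) ^ κ)
    (B : ℕ) :
    ∃ C : ℝ, ∀ N : ℕ, 1 ≤ N → |∑ n ∈ Icc 1 N, (f * g) n| ≤ C / (1 + Real.log N) ^ B := by
  obtain ⟨Kf, κf, hKf⟩ := hf'
  obtain ⟨Kg, κg, hKg⟩ := hg'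
  obtain ⟨Cg, hCg⟩ := hg (B + κf)
  obtain ⟨Cf, hCf⟩ := hf (B + κg)
  obtain ⟨Cf0, hCf0⟩ := hf B
  obtain ⟨Cg0, hCg0⟩ := hg 0
  have hCg_nn := nonneg_of_logPowDecay hCg
  have hCf_nn := nonneg_of_logPowDecay hCf
  have hCf0_nn := nonneg_of_logPowDecay hCf0
  have hCg0_nn := nonneg_of_logPowDecay hCg0
  have hKf_nn := nonneg_of_logPowBounded hKf
  have hKg_nn := nonneg_of_logPowBounded hKg
  set c₀ : ℝ := 1 - Real.log 2 with hc₀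
  have hc₀0 : 0 < c₀ := one_sub_log_two_pos
  refine ⟨Kf * Cg / c₀ ^ (B + κf) + Kg * Cf / c₀ ^ (B + κg) + Cf0 * Cg0 / c₀ ^ (B + 0), fun T hT => ?_⟩
  set Y := Nat.sqrt T with hYdef
  have hY1 : 1 ≤ Y := Nat.sqrt_pos.mpr hT
  have hYT : Y ≤ T := Nat.sqrt_le_self T
  have hY0 : (0 : ℝ) < Y := by exact_mod_cast hY1
  have hlog_nn : ∀ L : ℕ, 0 ≤ Real.log (L : ℝ) := fun L => Real.log_natCast_nonneg L
  have hLT : 0 < 1 + Real.log (T : ℝ) := by linarith [hlog_nn T]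
  have hkey : c₀ * (1 + Real.log T) ≤ 1 + Real.log Y := one_sub_log_two_mul_le_log_sqrt hT
  have hc₀ne : c₀ ≠ 0 := hc₀0.ne'
  have hLTne : 1 + Real.log (T : ℝ) ≠ 0 := hLT.ne'
  -- monotonicity in the length
  have hlogmono : ∀ {L L' : ℕ}, 1 ≤ L → L ≤ L' → 1 + Real.log L ≤ 1 + Real.log L' := by
    intro L L' hL hLL'
    have : (L : ℝ) ≤ L' := by exact_mod_cast hLL'
    have hL0 : (0 : ℝ) < L := by exact_mod_cast hL
    linarith [Real.log_le_log hL0 this]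
  -- transfer of a decay bound to lengths `L ≥ Y`
  have htrans : ∀ {C : ℝ} {B' : ℕ} {L : ℕ}, 0 ≤ C → Y ≤ L →
      C / (1 + Real.log L) ^ B' ≤ C / (c₀ * (1 + Real.log T)) ^ B' := by
    intro C B' L hC hL
    have h1 : c₀ * (1 + Real.log T) ≤ 1 + Real.log L := hkey.trans (hlogmono hY1 hL)
    exact div_le_div_of_nonneg_left hC (by positivity) (pow_le_pow_left₀ (by positivity) h1 B')
  -- generic weighted estimate
  have key : ∀ (s : Finset ℕ) (w G : ℕ → ℝ) (K C : ℝ) (κ : ℕ), 0 ≤ C →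
      (∀ m ∈ s, |G m| ≤ C / (c₀ * (1 + Real.log T)) ^ (B + κ)) →
      ∑ m ∈ s, |w m| ≤ K * (1 + Real.log T) ^ κ →
      |∑ m ∈ s, w m * G m| ≤ K * C / c₀ ^ (B + κ) / (1 + Real.log T) ^ B := by
    intro s w G K C κ hC hG hw
    calc |∑ m ∈ s, w m * G m| ≤ ∑ m ∈ s, |w m * G m| := abs_sum_le_sum_abs _ _
      _ = ∑ m ∈ s, |w m| * |G m| := by simp_rw [abs_mul]
      _ ≤ ∑ m ∈ s, |w m| * (C / (c₀ * (1 + Real.log T)) ^ (B + κ)) :=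
          sum_le_sum fun m hm => mul_le_mul_of_nonneg_left (hG m hm) (abs_nonneg _)
      _ = (∑ m ∈ s, |w m|) * (C / (c₀ * (1 + Real.log T)) ^ (B + κ)) := by rw [sum_mul]
      _ ≤ K * (1 + Real.log T) ^ κ * (C / (c₀ * (1 + Real.log T)) ^ (B + κ)) :=
          mul_le_mul_of_nonneg_right hw (by positivity)
      _ = K * C / c₀ ^ (B + κ) / (1 + Real.log T) ^ B := by
          rw [mul_pow, pow_add, pow_add]; field_simp
  rw [Icc_one_eq_Ioc_zero, sum_Ioc_mul_eq_hyperbola f g hYT]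
  -- the three pieces
  have hP1 : |∑ m ∈ Ioc 0 Y, f m * ∑ n ∈ Ioc 0 (T / m), g n|
      ≤ Kf * Cg / c₀ ^ (B + κf) / (1 + Real.log T) ^ B := by
    refine key _ (fun m => f m) (fun m => ∑ n ∈ Ioc 0 (T / m), g n) Kf Cg κf hCg_nn ?_ ?_
    · intro m hm
      simp only [mem_Ioc] at hm
      have hYm : Y ≤ T / m :=
        (Nat.le_div_iff_mul_le hm.1).mpr ((Nat.mul_le_mul_left Y hm.2).trans (Nat.sqrt_le T))
      rw [← Icc_one_eq_Ioc_zero]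
      exact (hCg _ (hY1.trans hYm)).trans (htrans hCg_nn hYm)
    · rw [← Icc_one_eq_Ioc_zero]
      exact (hKf Y hY1).trans
        (mul_le_mul_of_nonneg_left (pow_le_pow_left₀ (by linarith [hlog_nn Y]) (hlogmono hY1 hYT) _)
          hKf_nn)
  set L := T / (Y + 1) with hL
  have hLT' : L ≤ T := Nat.div_le_self _ _
  have hP2 : |∑ n ∈ Ioc 0 L, g n * ∑ m ∈ Ioc 0 (T / n), f m|
      ≤ Kg * Cf / c₀ ^ (B + κg) / (1 + Real.log T) ^ B := by
    refine key _ (fun n => g n) (fun n => ∑ m ∈ Ioc 0 (T / n), f m) Kg Cf κg hCf_nn ?_ ?_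
    · intro n hn
      simp only [mem_Ioc] at hn
      have hYn : Y ≤ T / n := by
        have h' : n * (Y + 1) ≤ T := (Nat.le_div_iff_mul_le (Nat.succ_pos Y)).mp hn.2
        have h'' : Y + 1 ≤ T / n := (Nat.le_div_iff_mul_le hn.1).mpr (by rwa [mul_comm] at h')
        omega
      rw [← Icc_one_eq_Ioc_zero]
      exact (hCf _ (hY1.trans hYn)).trans (htrans hCf_nn hYn)
    · rcases Nat.eq_zero_or_pos L with hL0 | hL0
      · rw [hL0, Finset.Ioc_self, sum_empty]; positivity
      · rw [← Icc_one_eq_Ioc_zero]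
        exact (hKg L hL0).trans
          (mul_le_mul_of_nonneg_left (pow_le_pow_left₀ (by linarith [hlog_nn L]) (hlogmono hL0 hLT') _)
            hKg_nn)
  have hP3 : |(∑ n ∈ Ioc 0 L, g n) * ∑ m ∈ Ioc 0 Y, f m|
      ≤ Cf0 * Cg0 / c₀ ^ (B + 0) / (1 + Real.log T) ^ B := by
    have hG : |∑ n ∈ Ioc 0 L, g n| ≤ Cg0 := by
      rcases Nat.eq_zero_or_pos L with hL0 | hL0
      · rw [hL0, Finset.Ioc_self, sum_empty, abs_zero]; exact hCg0_nn
      · have := hCg0 L hL0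
        rw [pow_zero, div_one, Icc_one_eq_Ioc_zero] at this
        exact this
    have hF : |∑ m ∈ Ioc 0 Y, f m| ≤ Cf0 / (c₀ * (1 + Real.log T)) ^ B := by
      rw [← Icc_one_eq_Ioc_zero]
      exact (hCf0 Y hY1).trans (htrans hCf0_nn le_rfl)
    rw [abs_mul]
    calc |∑ n ∈ Ioc 0 L, g n| * |∑ m ∈ Ioc 0 Y, f m| ≤ Cg0 * (Cf0 / (c₀ * (1 + Real.log T)) ^ B) :=
          mul_le_mul hG hF (abs_nonneg _) hCg0_nn
      _ = Cf0 * Cg0 / c₀ ^ (B + 0) / (1 + Real.log T) ^ B := by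
          rw [add_zero, mul_pow]; field_simp
  -- assemble
  have hsplit : ∑ n ∈ Ioc 0 L, g n * (∑ m ∈ Ioc 0 (T / n), f m - ∑ m ∈ Ioc 0 Y, f m)
      = ∑ n ∈ Ioc 0 L, g n * ∑ m ∈ Ioc 0 (T / n), f m - (∑ n ∈ Ioc 0 L, g n) * ∑ m ∈ Ioc 0 Y, f m := by
    simp only [mul_sub, sum_sub_distrib, sum_mul]
  rw [hsplit, add_div, add_div]
  calc |∑ m ∈ Ioc 0 Y, f m * ∑ n ∈ Ioc 0 (T / m), g n
        + (∑ n ∈ Ioc 0 L, g n * ∑ m ∈ Ioc 0 (T / n), f m - (∑ n ∈ Ioc 0 L, g n) * ∑ m ∈ Ioc 0 Y, f m)|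
      ≤ |∑ m ∈ Ioc 0 Y, f m * ∑ n ∈ Ioc 0 (T / m), g n|
        + (|∑ n ∈ Ioc 0 L, g n * ∑ m ∈ Ioc 0 (T / n), f m| + |(∑ n ∈ Ioc 0 L, g n) * ∑ m ∈ Ioc 0 Y, f m|) :=
        (abs_add_le _ _).trans (add_le_add le_rfl (abs_sub _ _))
    _ ≤ _ := by linarith [hP1, hP2, hP3]

/-- **Log-power decay is stable under convolution with an absolutely summable function with room:**
if `f` has log-power decay and `∑ |g(n)| n^δ < ∞` for some `δ > 0` then `f*g` has log-power decay. -/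
theorem logPowDecay_mul_of_summable {f g : ArithmeticFunction ℝ}
    (hf : ∀ B : ℕ, ∃ C : ℝ, ∀ N : ℕ, 1 ≤ N → |∑ n ∈ Icc 1 N, f n| ≤ C / (1 + Real.log N) ^ B)
    {δ : ℝ} (hδ : 0 < δ) (hg : Summable fun n => |g n| * (n : ℝ) ^ δ) (B : ℕ) :
    ∃ C : ℝ, ∀ N : ℕ, 1 ≤ N → |∑ n ∈ Icc 1 N, (f * g) n| ≤ C / (1 + Real.log N) ^ B := by
  obtain ⟨CB, hCB⟩ := hf B
  obtain ⟨C0, hC0⟩ := hf 0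
  have hCB_nn := nonneg_of_logPowDecay hCB
  have hC0_nn := nonneg_of_logPowDecay hC0
  obtain ⟨K, hK0, hK⟩ := exists_one_add_log_pow_le_mul_rpow (half_pos hδ) B
  set S : ℝ := ∑' n, |g n| * (n : ℝ) ^ δ with hS
  have hS_nn : 0 ≤ S := tsum_nonneg fun n => by positivity
  have hterm_nn : ∀ n : ℕ, 0 ≤ |g n| * (n : ℝ) ^ δ := fun n => by positivity
  set c₀ : ℝ := 1 - Real.log 2 with hc₀
  have hc₀0 : 0 < c₀ := one_sub_log_two_pos
  refine ⟨S * CB / c₀ ^ B + C0 * S * K, fun T hT => ?_⟩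
  set Y := Nat.sqrt T with hYdef
  have hY1 : 1 ≤ Y := Nat.sqrt_pos.mpr hT
  have hYT : Y ≤ T := Nat.sqrt_le_self T
  have hY0 : (0 : ℝ) < Y := by exact_mod_cast hY1
  have hT0 : (0 : ℝ) < T := by exact_mod_cast hT
  have hlog_nn : ∀ L : ℕ, 0 ≤ Real.log (L : ℝ) := fun L => Real.log_natCast_nonneg L
  have hLT : 0 < 1 + Real.log (T : ℝ) := by linarith [hlog_nn T]
  have hkey : c₀ * (1 + Real.log T) ≤ 1 + Real.log Y := one_sub_log_two_mul_le_log_sqrt hT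
  have hc₀ne : c₀ ≠ 0 := hc₀0.ne'
  have hLTne : 1 + Real.log (T : ℝ) ≠ 0 := hLT.ne'
  -- `∑_{n ≤ T} (f*g)(n) = ∑_{n ≤ T} g(n) F(T/n)`
  rw [Icc_one_eq_Ioc_zero, mul_comm, sum_Ioc_mul_eq_sum_sum,
    ← sum_filter_add_sum_filter_not (Ioc 0 T) (fun n => n ≤ Y)]
  -- part `n ≤ Y`
  have hP1 : |∑ n ∈ Ioc 0 T with n ≤ Y, g n * ∑ m ∈ Ioc 0 (T / n), f m|
      ≤ S * CB / c₀ ^ B / (1 + Real.log T) ^ B := by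
    have hfil : (Ioc 0 T).filter (fun n => n ≤ Y) = Ioc 0 Y := by
      ext n; simp only [mem_filter, mem_Ioc]; omega
    rw [hfil]
    have hF : ∀ n ∈ Ioc 0 Y, |∑ m ∈ Ioc 0 (T / n), f m| ≤ CB / (c₀ * (1 + Real.log T)) ^ B := by
      intro n hn
      simp only [mem_Ioc] at hn
      have hYn : Y ≤ T / n :=
        (Nat.le_div_iff_mul_le hn.1).mpr ((Nat.mul_le_mul_left Y hn.2).trans (Nat.sqrt_le T))
      have h1 : c₀ * (1 + Real.log T) ≤ 1 + Real.log ((T / n : ℕ) : ℝ) := by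
        have : (Y : ℝ) ≤ ((T / n : ℕ) : ℝ) := by exact_mod_cast hYn
        exact hkey.trans (by linarith [Real.log_le_log hY0 this])
      rw [← Icc_one_eq_Ioc_zero]
      exact (hCB _ (hY1.trans hYn)).trans
        (div_le_div_of_nonneg_left hCB_nn (by positivity) (pow_le_pow_left₀ (by positivity) h1 B))
    have hw : ∑ n ∈ Ioc 0 Y, |g n| ≤ S := by
      calc ∑ n ∈ Ioc 0 Y, |g n| ≤ ∑ n ∈ Ioc 0 Y, |g n| * (n : ℝ) ^ δ := by
            refine sum_le_sum fun n hn => ?_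
            simp only [mem_Ioc] at hn
            have : (1 : ℝ) ≤ (n : ℝ) ^ δ := Real.one_le_rpow (by exact_mod_cast hn.1) hδ.le
            nlinarith [abs_nonneg (g n)]
        _ ≤ S := hg.sum_le_tsum _ fun n _ => hterm_nn n
    calc |∑ n ∈ Ioc 0 Y, g n * ∑ m ∈ Ioc 0 (T / n), f m|
        ≤ ∑ n ∈ Ioc 0 Y, |g n * ∑ m ∈ Ioc 0 (T / n), f m| := abs_sum_le_sum_abs _ _
      _ = ∑ n ∈ Ioc 0 Y, |g n| * |∑ m ∈ Ioc 0 (T / n), f m| := by simp_rw [abs_mul]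
      _ ≤ ∑ n ∈ Ioc 0 Y, |g n| * (CB / (c₀ * (1 + Real.log T)) ^ B) :=
          sum_le_sum fun n hn => mul_le_mul_of_nonneg_left (hF n hn) (abs_nonneg _)
      _ = (∑ n ∈ Ioc 0 Y, |g n|) * (CB / (c₀ * (1 + Real.log T)) ^ B) := by rw [sum_mul]
      _ ≤ S * (CB / (c₀ * (1 + Real.log T)) ^ B) := mul_le_mul_of_nonneg_right hw (by positivity)
      _ = S * CB / c₀ ^ B / (1 + Real.log T) ^ B := by rw [mul_pow]; field_simp
  -- part `n > Y`
  have hP2 : |∑ n ∈ Ioc 0 T with ¬ n ≤ Y, g n * ∑ m ∈ Ioc 0 (T / n), f m|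
      ≤ C0 * S * K / (1 + Real.log T) ^ B := by
    have hF : ∀ n ∈ (Ioc 0 T).filter (fun n => ¬ n ≤ Y), |∑ m ∈ Ioc 0 (T / n), f m| ≤ C0 := by
      intro n hn
      simp only [mem_filter, mem_Ioc] at hn
      have h1 : 1 ≤ T / n := (Nat.le_div_iff_mul_le hn.1.1).mpr (by simpa using hn.1.2)
      have := hC0 _ h1
      rw [pow_zero, div_one, Icc_one_eq_Ioc_zero] at this
      exact this
    have htail : ∀ n ∈ (Ioc 0 T).filter (fun n => ¬ n ≤ Y),
        |g n| ≤ |g n| * (n : ℝ) ^ δ * ((Y : ℝ) + 1) ^ (-δ) := by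
      intro n hn
      simp only [mem_filter, mem_Ioc, not_le] at hn
      have hn1 : (Y : ℝ) + 1 ≤ n := by exact_mod_cast hn.2
      have hn0 : (0 : ℝ) < n := by exact_mod_cast hn.1.1
      have h1 : (n : ℝ) ^ (-δ) ≤ ((Y : ℝ) + 1) ^ (-δ) :=
        Real.rpow_le_rpow_of_nonpos (by positivity) hn1 (by linarith)
      have h2 : |g n| = |g n| * (n : ℝ) ^ δ * (n : ℝ) ^ (-δ) := by
        rw [mul_assoc, ← Real.rpow_add hn0, add_neg_cancel, Real.rpow_zero, mul_one]
      calc |g n| = |g n| * (n : ℝ) ^ δ * (n : ℝ) ^ (-δ) := h2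
        _ ≤ |g n| * (n : ℝ) ^ δ * ((Y : ℝ) + 1) ^ (-δ) :=
            mul_le_mul_of_nonneg_left h1 (hterm_nn n)
    have hw : ∑ n ∈ Ioc 0 T with ¬ n ≤ Y, |g n| ≤ S * ((Y : ℝ) + 1) ^ (-δ) := by
      calc ∑ n ∈ Ioc 0 T with ¬ n ≤ Y, |g n|
          ≤ ∑ n ∈ Ioc 0 T with ¬ n ≤ Y, |g n| * (n : ℝ) ^ δ * ((Y : ℝ) + 1) ^ (-δ) :=
            sum_le_sum htail
        _ = (∑ n ∈ Ioc 0 T with ¬ n ≤ Y, |g n| * (n : ℝ) ^ δ) * ((Y : ℝ) + 1) ^ (-δ) := by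
            rw [sum_mul]
        _ ≤ S * ((Y : ℝ) + 1) ^ (-δ) :=
            mul_le_mul_of_nonneg_right (hg.sum_le_tsum _ fun n _ => hterm_nn n) (by positivity)
    -- `(Y+1)^{-δ} ≤ T^{-δ/2} ≤ K/(1 + log T)^B`
    have hYpow : ((Y : ℝ) + 1) ^ (-δ) ≤ K / (1 + Real.log T) ^ B := by
      have hT2 : (T : ℝ) ≤ ((Y : ℝ) + 1) ^ (2 : ℝ) := by
        have h : T < (Y + 1) * (Y + 1) := Nat.lt_succ_sqrt T
        have : (T : ℝ) ≤ ((Y : ℝ) + 1) * ((Y : ℝ) + 1) := by exact_mod_cast h.le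
        rw [Real.rpow_two, sq]; exact this
      have h1 : ((Y : ℝ) + 1) ^ (-δ) ≤ (T : ℝ) ^ (-(δ / 2)) := by
        have : ((Y : ℝ) + 1) ^ (-δ) = (((Y : ℝ) + 1) ^ (2 : ℝ)) ^ (-(δ / 2)) := by
          rw [← Real.rpow_mul (by positivity)]; congr 1; ring
        rw [this]
        exact Real.rpow_le_rpow_of_nonpos hT0 hT2 (by linarith)
      have h2 : (T : ℝ) ^ (-(δ / 2)) ≤ K / (1 + Real.log T) ^ B := by
        rw [le_div_iff₀ (by positivity), Real.rpow_neg hT0.le]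
        have := hK T (by exact_mod_cast hT)
        calc ((T : ℝ) ^ (δ / 2))⁻¹ * (1 + Real.log T) ^ B ≤ ((T : ℝ) ^ (δ / 2))⁻¹ * (K * (T : ℝ) ^ (δ / 2)) :=
              mul_le_mul_of_nonneg_left this (by positivity)
          _ = K := by field_simp
      exact h1.trans h2
    calc |∑ n ∈ Ioc 0 T with ¬ n ≤ Y, g n * ∑ m ∈ Ioc 0 (T / n), f m|
        ≤ ∑ n ∈ Ioc 0 T with ¬ n ≤ Y, |g n * ∑ m ∈ Ioc 0 (T / n), f m| := abs_sum_le_sum_abs _ _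
      _ = ∑ n ∈ Ioc 0 T with ¬ n ≤ Y, |g n| * |∑ m ∈ Ioc 0 (T / n), f m| := by simp_rw [abs_mul]
      _ ≤ ∑ n ∈ Ioc 0 T with ¬ n ≤ Y, |g n| * C0 :=
          sum_le_sum fun n hn => mul_le_mul_of_nonneg_left (hF n hn) (abs_nonneg _)
      _ = (∑ n ∈ Ioc 0 T with ¬ n ≤ Y, |g n|) * C0 := by rw [sum_mul]
      _ ≤ S * ((Y : ℝ) + 1) ^ (-δ) * C0 := mul_le_mul_of_nonneg_right hw hC0_nn
      _ ≤ S * (K / (1 + Real.log T) ^ B) * C0 :=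
          mul_le_mul_of_nonneg_right (mul_le_mul_of_nonneg_left hYpow hS_nn) hC0_nn
      _ = C0 * S * K / (1 + Real.log T) ^ B := by field_simp
  rw [add_div]
  exact (abs_add_le _ _).trans (add_le_add hP1 hP2)

end Summit.Parity.BatemanHorn.Theorems
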